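import Summits.BirchSwinnertonDyer.BirchSwinnertonDyer.Theorems.EdixhovenFibreFiveSevenStarredOptimalManinUnitFiveSevenTransportedHodgePairHneOmega
import Literature.NumberTheory.PAdicHodge.UnitRootFrameReciprocityFormalPointTransport
import Literature.NumberTheory.PAdicHodge.FormalTateModuleRankOne
import Literature.NumberTheory.PAdicHodge.FrobeniusUnitRoot
import Literature.NumberTheory.PAdicHodge.BmaxPlusTransportedPeriodHom
import Literature.NumberTheory.PAdicHodge.FontaineThetaLocalField
import HarnessLib

/-!
# Kato's explicit reciprocity law for a curve `W/K₀` ISOMORPHIC over `K_v` to a RAMIFIED good ORDINARY model `W_D ≡ E₀ (mod ϖ)`, from the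
# cells' data and (N1′) alone — the unit-root frame assembled along a transport `φ` (the inner shape of the ordinary capstone socket `hcap`)

Cell `pub/bsd-wall`, D-0145 line `route-BirchSwinnertonDyer-EdixhovenFibreFiveSeven`, seat `bsd-line-edix-p4` (gen 30); crux K★
`stmt-BirchSwinnertonDyer-22226` (`StarredOptimalManinUnitFiveSeven`), line `kato_lever`, stub `stub_localFormulaOrdinaryCells`; memos
`Cruxes/StarredOptimalManinUnitFiveSeven/Lines/kato-lever-ordinary-cells-width.md` §5 (the socket `hcap`) and `…/kato-lever-seam-rec-at-cells.md` §17–§18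
(the unit-root frame). THEOREMS ONLY (no definition, no named fact, no instance, no `sorry`); helper `--supports stmt-BirchSwinnertonDyer-22226`.
**BSD is not proved by this file, and neither is K★ or [REC-tower].**

The ORDINARY twin of `…TransportedReciprocityTransport` (p784711): for a good ORDINARY `𝒪_D`-model `E = curveFO F (W_D ⊗_ψ 𝒪_F)` (`F = K_v`) with
`W_D ≡ E₀ (mod ϖ)`, `E₀/ℤ` good ordinary (`‖a_p(E₀)‖ = 1`), `[Xᵖ][p]_{W_D ⊗ 𝒪_F} ∈ 𝒪_ℂˣ` (height one), a depth `N ≥ e`, (N1′) `∫_τ ω_{W_D} ≠ 0` for SOME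
`τ ∈ T_pŴ_D`, and the socket data of a curve `W/K₀` over `F` (Weil tower, `ψ = log χ`, `hinj / hde / d`) together with an equivariant
`φ : (W ⊗ F)(F̄) ≃ E(F̄)` with `T_p(φ)`, there is ONE `c ∈ F` with **`⟨[η], P⟩_W = −Tr_{F/ℚ_p}(c_P · exp*_d(η) · c)`** at every cocycle `η` of `T_pW|_{Γ_F}`,
every `P ∈ W(F)` carrying a tower `Q` whose image `φ ∘ Q` is FORMAL with `‖z(φ Q₀)‖^N ≤ ‖p‖`, and every `c_P` with `ι(c_P) = p^N·Σ'[Xʲ]log_{W_D}·z(φ Q₀)ʲ`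
— LITERALLY the inner block of `hcap` in `…LocalFormulaOrdinaryCellsOfCapstone.localFormula_of_ordinary_numerology_of_capstone` for one `φ`.

Assembly (all inputs are tree theorems): `LT` by `exists_addMonoidHom_logSum_transport`; the Hodge line `(A, B, dHL)` and `hne` at the (N1′)-witness by
the REDUCTION-AGNOSTIC package `TransportedHodgePairHneOmega.exists_hodgePair_fil_and_hne`; the generator `v₀` of `T_pŴ_D` with its character `ρ` by
`FormalTateModuleRankOne.exists_generator_tatePtO_of_isUnit`; `hne` moved from `τ = c₁•v₀` to `v₀` (§1, generic `F`); the unit root `α` by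
`FrobeniusUnitRoot.exists_unitRoot_frobeniusPoly`; then `UnitRootFrameReciprocityFormalPointTransport` (p797918).

* §1 `hodgeCombination_ne_zero_of_smul` — `ι(A)f(LT(c•v₀)) + ι(B)fφ(LT(c•v₀)) = f(ι c)·(ι(A)f(LT v₀) + ι(B)fφ(LT v₀))`, so non-vanishing descends to `v₀`.
* §2 ★★★★ `exists_const_tatePairingPoint_eq_neg_trace_of_omegaPeriod_ne_zero_unitRoot_transport`.

What a K★ cell must still supply for `hcap`: (N1′) at its ordinary model (the seat LEAD's T2), `p ≠ 2`, and `N := e`.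

References: [cite: Kato1993LNM1553, Ch. II Thm. 1.4.1 (3)–(4), Lemma 1.4.3] · [cite: BlochKato1990, Ex. 3.10.1, Example 3.11] ·
[cite: Colmez1992PeriodesAbeliennes, §2] · [cite: Katz1981CrystallineDieudonne, Thm. 5.1.4–5.1.5] · [cite: Tate1967, §4] · [cite: SilvermanAEC2009, Prop. VII.2.2, VIII §2, X §4].
-/

set_option autoImplicit false
-- single-conjunct summit: `Summit.BirchSwinnertonDyer.BirchSwinnertonDyer.…` repeats the name by design
set_option linter.dupNamespace false

noncomputable section

open Field Function ValuativeRel WittVector NumberField IsDedekindDomain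
open scoped NumberField Topology Classical NNReal
open Literature.NumberTheory.PAdicHodge Literature.NumberTheory.GaloisRepresentations
  Literature.NumberTheory.GaloisRepresentations.IsNonarchimedeanLocalField Literature.NumberTheory.GaloisRepresentations.LubinTate
  Literature.NumberTheory.GaloisCohomology Literature.NumberTheory.EllipticCurves Literature.NumberTheory.EllipticCurves.FormalGroupChart
  Literature.NumberTheory.PAdicHodge.GaloisContinuity Literature.IUT.LogVolume Literature.RingTheory.FormalGroups
  Literature.AlgebraicGeometry.Resolution _root_.WeierstrassCurve

namespace Summit.BirchSwinnertonDyer.BirchSwinnertonDyer.Theorems.UnitRootReciprocityTransport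

/-! ## §1 Non-vanishing of the Hodge combination descends along `ℤ_p`-multiples (generic `F`) -/

section Generic

variable {F : Type} [Field F] [ValuativeRel F] [TopologicalSpace F] [IsNonarchimedeanLocalField F] [CharZero F]
  {p : ℕ} [Fact p.Prime] [Fact (¬ IsUnit (p : integerC F))] [IsAdicComplete (Ideal.span {(p : integerC F)}) (integerC F)]

set_option maxHeartbeats 1600000 in
set_option synthInstance.maxHeartbeats 400000 in
/-- **`hne` descends from `c • v₀` to `v₀`.** For an additive `LT : T → A_max` with `LT(c • τ) = ι(c)·LT(τ)` (`ℤ_p`-linearity), the Hodge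
combination `H(τ) := ι(A)f(LT τ) + ι(B)fφ(LT τ)` satisfies `H(c • v₀) = f(ι c)·H(v₀)` (`φ` fixes `ι(ℤ_p)`); hence
`of(ι A)·of(f LT(c•v₀)) + of(ι B)·of(fφ LT(c•v₀)) ≠ 0 ⟹ H(v₀) ≠ 0`. [cite: FontaineOuyang2022, §6.1] -/
theorem hodgeCombination_ne_zero_of_smul (hp : valuation F p < 1) (hF : Function.Surjective (fontaineTheta (integerC F) p))
    {T : Type} [AddCommGroup T] [Module ℤ_[p] T] (LT : T →+ BmaxPlus F p)
    (hsmul : ∀ (c : ℤ_[p]) (τ : T), LT (c • τ) = ainfToBmaxPlus F p (zpToAinf c) * LT τ)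
    (A B : F) (c : ℤ_[p]) (v₀ : T)
    (hne : BdRPlusTop.of F p (embBdRHom hp hF A) * BdRPlusTop.of F p (bmaxPlusToBdR F p (LT (c • v₀))) +
      BdRPlusTop.of F p (embBdRHom hp hF B) * BdRPlusTop.of F p (bmaxPlusToBdR F p (frobBmaxPlus F p (LT (c • v₀)))) ≠ 0) :
    embBdRHom hp hF A * bmaxPlusToBdR F p (LT v₀) + embBdRHom hp hF B * bmaxPlusToBdR F p (frobBmaxPlus F p (LT v₀)) ≠ 0 := by
  intro h0
  apply hne
  have hφc : frobBmaxPlus F p (ainfToBmaxPlus F p (zpToAinf c)) = ainfToBmaxPlus F p (zpToAinf c) := by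
    rw [frobBmaxPlus_ainfToBmaxPlus, frobenius_zpToAinf]
  have h1 : embBdRHom hp hF A * bmaxPlusToBdR F p (LT (c • v₀)) + embBdRHom hp hF B * bmaxPlusToBdR F p (frobBmaxPlus F p (LT (c • v₀))) =
      bmaxPlusToBdR F p (ainfToBmaxPlus F p (zpToAinf c)) *
        (embBdRHom hp hF A * bmaxPlusToBdR F p (LT v₀) + embBdRHom hp hF B * bmaxPlusToBdR F p (frobBmaxPlus F p (LT v₀))) := by
    rw [hsmul, map_mul (frobBmaxPlus F p), hφc, map_mul (bmaxPlusToBdR F p), map_mul (bmaxPlusToBdR F p)]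
    ring
  rw [← map_mul, ← map_mul, ← map_add, h1, h0, mul_zero, map_zero]

end Generic

/-! ## §2 The ordinary twin of `…TransportedReciprocityTransport`: `hcap`'s inner shape from the cells' data and (N1′) -/

section Completion

variable {K : Type} [Field K] [NumberField K] {p : ℕ} [hprime : Fact p.Prime] (v : HeightOneSpectrum (𝓞 K))
  [CharZero (v.adicCompletion K)] [LocallyCompactSpace (absoluteGaloisGroup (v.adicCompletion K))]
  [Fact (¬ IsUnit (p : integerC (v.adicCompletion K)))]
  [IsAdicComplete (Ideal.span {(p : integerC (v.adicCompletion K))}) (integerC (v.adicCompletion K))]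
  [CharP 𝓀[v.adicCompletion K] p] [CharZero (CompletedAlgClosure (v.adicCompletion K))]
  (hpv : valuation (v.adicCompletion K) (p : v.adicCompletion K) < 1)
  (Dv : EisensteinRoot (v.adicCompletion K) p hpv) (Wm : WeierstrassCurve (EisensteinRoot.CoeffDisc Dv))
  (ψm : EisensteinRoot.CoeffDisc Dv →+* LTCoeff (v.adicCompletion K))
  (hψm : ∀ c, algebraMap (LTCoeff (v.adicCompletion K)) (v.adicCompletion K) (ψm c) = EisensteinRoot.CoeffDisc.toF Dv c)
  (hp2 : p ≠ 2) (hΔ : IsUnit (Wm.map ψm).Δ)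
  (h1 : IsUnit (algebraMap (LTCoeff (v.adicCompletion K)) (CBall (v.adicCompletion K)) (PowerSeries.coeff p ((Wm.map ψm).formalMul p))))
  [(curveOver (CompletedAlgClosure (v.adicCompletion K)) (Wm.map ψm)).IsElliptic]
  -- the curve `W/K₀`, the isomorphism of geometric points onto the good model, and its Tate-module map
  {K₀ : Type} [Field K₀] [CharZero K₀] (W : WeierstrassCurve K₀) [W.IsElliptic] [Algebra K₀ (v.adicCompletion K)]
  (φ : geomPoints (W.baseChange (v.adicCompletion K)) ≃+ (AinfTop.curveFO (v.adicCompletion K) (Wm.map ψm)).geomPoints)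
  (hφ : ∀ (σ : absoluteGaloisGroup (v.adicCompletion K)) (P : geomPoints (W.baseChange (v.adicCompletion K))), φ (σ • P) = σ • φ P)
  (Tφ : (W.baseChange (v.adicCompletion K)).tateModule p ≃ₗ[ℤ_[p]] (AinfTop.curveFO (v.adicCompletion K) (Wm.map ψm)).tateModule p)
  (hTφ : ∀ (a : (W.baseChange (v.adicCompletion K)).tateModule p) (n : ℕ), TateModule.proj p n (Tφ a) = φ (TateModule.proj p n a))
  -- the Weil tower of `W`
  (e : (k : ℕ) → geomTorsion W ((p ^ k : ℕ) : ℤ) → geomTorsion W ((p ^ k : ℕ) : ℤ) → AlgebraicClosure K₀)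
  (hμ : ∀ k S T, e k S T ^ (p ^ k) = 1) (hadd₁ : ∀ k S₁ S₂ T, e k (S₁ + S₂) T = e k S₁ T * e k S₂ T)
  (hadd₂ : ∀ k S T₁ T₂, e k S (T₁ + T₂) = e k S T₁ * e k S T₂)
  (hgal : ∀ k (σ : absoluteGaloisGroup K₀) (S T : geomTorsion W ((p ^ k : ℕ) : ℤ)), σ • e k S T = e k (σ • S) (σ • T))
  (hcompat : ∀ k (S T : geomTorsion W ((p ^ (k + 1) : ℕ) : ℤ)),
    e k (torsionMulHom W (p ^ (k + 1)) (p ^ k) p (pow_succ p k).symm S)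
      (torsionMulHom W (p ^ (k + 1)) (p ^ k) p (pow_succ p k).symm T) = e (k + 1) S T ^ p)

set_option maxHeartbeats 6400000 in
include hgal hp2 hΔ h1 hψm hφ hTφ in
/-- ★★★★ **Kato's explicit reciprocity law for `W/K₀` (isomorphic over `F = K_v` to a ramified good ORDINARY model) at the points of `W(F)` whose
division tower maps to FORMAL points of the model, deep at the base — from the cells' data and (N1′) alone; the inner shape of the ordinary capstone
socket `hcap` for ONE transport `φ`.** `E = curveFO F (W_D ⊗_ψ 𝒪_F)` with `Δ ∈ 𝒪_Fˣ` and `[Xᵖ][p] ∈ 𝒪_ℂˣ` (height one); `W_D ≡ E₀ (mod ϖ)`, `E₀/ℤ`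
with `E₀ ⊗ ℚ_p`, `E₀ ⊗ 𝔽_p` elliptic and `‖a_p(E₀)‖ = 1` (ORDINARY); `p ≠ 2`; `φ : (W ⊗ F)(F̄) ≃ E(F̄)` equivariant with Tate-module map `T_p(φ)`;
an index `N ≥ e`; (N1′) `∫_τ ω_{W_D} ≠ 0` for some `τ ∈ T_pŴ_D`; the cell data of the socket FOR `W` (Weil tower of `W` with `heL/healt/henondeg`,
`ψ = log χ`, de Rham binders of `T_pW|_{Γ_F}`). Then there is ONE `c ∈ F` such that for every `η ∈ Z¹(Γ_F, T_pW)`, every `P ∈ W(F)` with a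
`p`-power division tower `Q` in `W(F̄)` (`Q₀ = P`) all of whose images `φ Qₙ` are formal points of `E` and `‖z(φ Q₀)‖^N ≤ ‖p‖`, and every `c_P ∈ F`
with `ι(c_P) = p^N·Σ'[Xʲ]log_{W_D}·z(φ Q₀)ʲ`: **`⟨[η], P⟩_W = −Tr_{F/ℚ_p}(c_P · exp*_d(η) · c)`** — pairing, `exp*`, `d`, representation those of `W`
ITSELF; NO Hodge-line, `hne`, (K₂), cocycle, integrating-pair, period-map, frame or unit-root hypothesis.
[cite: Kato1993LNM1553, Ch. II Thm. 1.4.1 (3)–(4), Lemma 1.4.3] [cite: BlochKato1990, Ex. 3.10.1, Example 3.11] [cite: Colmez1992PeriodesAbeliennes, §2]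
[cite: Katz1981CrystallineDieudonne, Thm. 5.1.4–5.1.5] [cite: Tate1967, §4] -/
theorem exists_const_tatePairingPoint_eq_neg_trace_of_omegaPeriod_ne_zero_unitRoot_transport
    (E₀ : WeierstrassCurve ℤ)
    (hWE : Wm.map (Ideal.Quotient.mk (Ideal.span {EisensteinRoot.CoeffDisc.of Dv (AdjoinRoot.root Dv.poly)})) =
      (E₀.map (algebraMap ℤ (EisensteinRoot.CoeffDisc Dv))).map
        (Ideal.Quotient.mk (Ideal.span {EisensteinRoot.CoeffDisc.of Dv (AdjoinRoot.root Dv.poly)})))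
    [(E₀.map (Int.castRingHom ℚ_[p])).IsElliptic] [(E₀.map (Int.castRingHom (ZMod p))).IsElliptic]
    (hnorm : ‖((HasseManin.tr (E₀.map (Int.castRingHom (ZMod p))) : ℤ) : ℤ_[p])‖ = 1)
    {N : ℕ} (hN : Dv.e ≤ N)
    (hN1' : ∃ τ : AinfTop.TatePtO (v.adicCompletion K) (Wm.map ψm) p,
      AinfRamTop.omegaPeriod Wm (surjective_fontaineTheta_integerC hpv) (AinfTop.seqO (Wm.map ψm) τ) (AinfTop.seqO_zero (Wm.map ψm) τ)
        (AinfRamTop.mulPC_seqO Wm ψm hψm τ) ≠ 0)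
    (ψ : C(absoluteGaloisGroup (v.adicCompletion K), ℤ_[p])) (hψ : ∀ σ τ, ψ (σ * τ) = ψ σ + ψ τ)
    (hψlog : ∀ τ, (ψ τ : ℚ_[p]) = logCyclotomic (F := (v.adicCompletion K)) p τ)
    (heL : ∀ (c : ℤ_[p]) (S U : W.tateModule p),
      (weilContPairingPadic W (v.adicCompletion K) p e hμ hadd₁ hadd₂ hgal hcompat).toLin (c • S) U =
      twistHom (v.adicCompletion K) p ((weilContPairingPadic W (v.adicCompletion K) p e hμ hadd₁ hadd₂ hgal hcompat).toLin S U) c)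
    (healt : ∀ S : W.tateModule p,
      (weilContPairingPadic W (v.adicCompletion K) p e hμ hadd₁ hadd₂ hgal hcompat).toLin S S = 0)
    (henondeg : ∀ S : W.tateModule p,
      (∀ U, (weilContPairingPadic W (v.adicCompletion K) p e hμ hadd₁ hadd₂ hgal hcompat).toLin S U = 0) → S = 0)
    (hinj : letI := LocalField.padicAlgebra (v.adicCompletion K) p hpv
      (bdRPeriodRingData (F := (v.adicCompletion K)) (p := p) hpv).CupLogInjective (logCyclotomic p)
        (restrictedRationalTateRep W (v.adicCompletion K) p))
    (hde : letI := LocalField.padicAlgebra (v.adicCompletion K) p hpv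
      ∀ η : contOneCocycles (restrictedTateRep W (v.adicCompletion K) p).toTopRep,
        (bdRPeriodRingData (F := (v.adicCompletion K)) (p := p) hpv).HasDualExp (logCyclotomic p)
          (restrictedRationalTateRep W (v.adicCompletion K) p)
          fun σ => TateModule.toRational p (η.1 σ))
    (d : letI := LocalField.padicAlgebra (v.adicCompletion K) p hpv
      (bdRPeriodRingData (F := (v.adicCompletion K)) (p := p) hpv).FilZeroLine
        (restrictedRationalTateRep W (v.adicCompletion K) p)) :
    letI := LocalField.padicAlgebra (v.adicCompletion K) p hpv
    ∃ c : v.adicCompletion K,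
      ∀ (η : contOneCocycles (restrictedTateRep W (v.adicCompletion K) p).toTopRep)
        (P : (W.baseChange (v.adicCompletion K)).toAffine.Point)
        (Q : ℕ → geomPoints (W.baseChange (v.adicCompletion K)))
        (_hQ : ∀ n, p • Q (n + 1) = Q n)
        (_hQ0 : Q 0 = toGeomPoints (W.baseChange (v.adicCompletion K)) P)
        (hker : ∀ n, AinfTop.geomToCO (Wm.map ψm) ((⇑φ ∘ Q) n) ∈ kernel (NormedField.valuation (K := CompletedAlgClosure (v.adicCompletion K)))
          (curveOver (CompletedAlgClosure (v.adicCompletion K)) (Wm.map ψm))),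
        ‖((zPt (AinfTop.geomToCO (Wm.map ψm) ((⇑φ ∘ Q) 0)) (hker 0) : CBall (v.adicCompletion K)) : CompletedAlgClosure (v.adicCompletion K))‖ ^ N ≤
            ‖(p : CompletedAlgClosure (v.adicCompletion K))‖ →
        ∀ cP : v.adicCompletion K,
          algebraMap (v.adicCompletion K) (CompletedAlgClosure (v.adicCompletion K)) cP =
            (p : CompletedAlgClosure (v.adicCompletion K)) ^ N *
              ∑' j : ℕ, PowerSeries.coeff j (Wm.map ((CBall (v.adicCompletion K)).subtype.comp (EisensteinRoot.CoeffDisc.toCBall Dv))).formalLog *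
                ((zPt (AinfTop.geomToCO (Wm.map ψm) ((⇑φ ∘ Q) 0)) (hker 0) : CBall (v.adicCompletion K)) : CompletedAlgClosure (v.adicCompletion K)) ^ j →
          ((tatePairingPoint W (v.adicCompletion K) p e hμ hadd₁ hadd₂ hgal hcompat
              (oneCocycleClass _ η) P : ℤ_[p]) : ℚ_[p]) =
            -Algebra.trace ℚ_[p] (v.adicCompletion K) (cP * (expStarCoord W hpv d η * c)) := by
  -- the transported period map `LT` at index `N` (specification, `ℤ_p`-linearity, `Γ_F`-equivariance)
  obtain ⟨LT, hLT, hsmul, hgalLT⟩ := exists_addMonoidHom_logSum_transport Dv Wm E₀ hWE ψm hψm (hθ := surjective_fontaineTheta_integerC hpv) hN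
  -- its `B_dR⁺` shadows `P⁰ = f ∘ LT`, `Q⁰ = f ∘ φ ∘ LT` (raw ∃-witnesses, no `let`)
  have hP₀' : ∃ P₀ : AinfTop.TatePtO (v.adicCompletion K) (Wm.map ψm) p →+ BdRPlusTop (v.adicCompletion K) p,
      ∀ τ, P₀ τ = BdRPlusTop.of (v.adicCompletion K) p (bmaxPlusToBdR (v.adicCompletion K) p (LT τ)) :=
    ⟨((BdRPlusTop.of (v.adicCompletion K) p).toRingHom.comp (bmaxPlusToBdR (v.adicCompletion K) p)).toAddMonoidHom.comp LT, fun _ => rfl⟩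
  obtain ⟨P₀, hP₀⟩ := hP₀'
  have hQ₀' : ∃ Q₀ : AinfTop.TatePtO (v.adicCompletion K) (Wm.map ψm) p →+ BdRPlusTop (v.adicCompletion K) p,
      ∀ τ, Q₀ τ = BdRPlusTop.of (v.adicCompletion K) p (bmaxPlusToBdR (v.adicCompletion K) p (frobBmaxPlus (v.adicCompletion K) p (LT τ))) :=
    ⟨(((BdRPlusTop.of (v.adicCompletion K) p).toRingHom.comp (bmaxPlusToBdR (v.adicCompletion K) p)).comp
      (frobBmaxPlus (v.adicCompletion K) p)).toAddMonoidHom.comp LT, fun _ => rfl⟩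
  obtain ⟨Q₀, hQ₀⟩ := hQ₀'
  haveI := isDomain_bDeRhamPlus (F := v.adicCompletion K) (p := p) (surjective_fontaineTheta_integerC hpv)
  haveI : IsDomain (BdRPlusTop (v.adicCompletion K) p) := isDomain_bDeRhamPlus (F := v.adicCompletion K) (p := p)
    (surjective_fontaineTheta_integerC hpv)
  -- the REDUCTION-AGNOSTIC one-call package: Hodge-line scalars with their analytic bound, `Fil¹`, and `hne` from (N1′)
  obtain ⟨a, b, dHL, c, hHLsum, -, hneΩ⟩ := TransportedHodgePairHneOmega.exists_hodgePair_fil_and_hne Dv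
    (hθ := surjective_fontaineTheta_integerC hpv) Wm E₀ hWE ψm hψm hp2 hN hLT hP₀ hQ₀
  -- the scalars `A = Σ aᵢϖⁱ`, `B = Σ bᵢϖⁱ` of `F`
  have hA'' : ∃ A' : v.adicCompletion K,
      A' = ∑ i : Fin Dv.e, algebraMap (PadicBase (v.adicCompletion K) p hpv) (v.adicCompletion K) (a i) * Dv.root ^ (i : ℕ) := ⟨_, rfl⟩
  obtain ⟨A, hA'⟩ := hA''
  have hB'' : ∃ B' : v.adicCompletion K,
      B' = ∑ i : Fin Dv.e, algebraMap (PadicBase (v.adicCompletion K) p hpv) (v.adicCompletion K) (b i) * Dv.root ^ (i : ℕ) := ⟨_, rfl⟩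
  obtain ⟨B, hB'⟩ := hB''
  have hAC : algebraMap (v.adicCompletion K) (CompletedAlgClosure (v.adicCompletion K)) A =
      ∑ i : Fin Dv.e, algebraMap (v.adicCompletion K) (CompletedAlgClosure (v.adicCompletion K))
        (algebraMap (PadicBase (v.adicCompletion K) p hpv) (v.adicCompletion K) (a i)) *
          ((Dv.rootC : integerC (v.adicCompletion K)) : CompletedAlgClosure (v.adicCompletion K)) ^ (i : ℕ) := by
    rw [hA', map_sum]
    refine Finset.sum_congr rfl fun i _ => ?_
    rw [map_mul, map_pow, EisensteinRoot.coe_rootC]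
  have hBC : algebraMap (v.adicCompletion K) (CompletedAlgClosure (v.adicCompletion K)) B =
      ∑ i : Fin Dv.e, algebraMap (v.adicCompletion K) (CompletedAlgClosure (v.adicCompletion K))
        (algebraMap (PadicBase (v.adicCompletion K) p hpv) (v.adicCompletion K) (b i)) *
          ((Dv.rootC : integerC (v.adicCompletion K)) : CompletedAlgClosure (v.adicCompletion K)) ^ (i : ℕ) := by
    rw [hB', map_sum]
    refine Finset.sum_congr rfl fun i _ => ?_
    rw [map_mul, map_pow, EisensteinRoot.coe_rootC]
  -- the Hodge line in the shape of the frame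
  have hHL : ∀ n : ℕ, ‖(p : CompletedAlgClosure (v.adicCompletion K)) ^ dHL * PowerSeries.coeff n
      ((Wm.map ((CBall (v.adicCompletion K)).subtype.comp (EisensteinRoot.CoeffDisc.toCBall Dv))).formalLog -
        PowerSeries.C (algebraMap (v.adicCompletion K) (CompletedAlgClosure (v.adicCompletion K)) A) *
          (E₀.map (Int.castRingHom (CompletedAlgClosure (v.adicCompletion K)))).formalLog -
        PowerSeries.C (algebraMap (v.adicCompletion K) (CompletedAlgClosure (v.adicCompletion K)) B) *
          PowerSeries.expand p hprime.out.ne_zero (E₀.map (Int.castRingHom (CompletedAlgClosure (v.adicCompletion K)))).formalLog)‖ ≤ 1 := by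
    rw [hAC, hBC]; exact hHLsum
  -- the generator `v₀` of `T_pŴ_D` (height one) and its character `ρ`
  obtain ⟨v₀, hv₀, hgen, ρ, hρ⟩ := exists_generator_tatePtO_of_isUnit (norm_natCast_C_lt_one hpv) (Wm.map ψm) h1
  have hρv : ∀ σ : absoluteGaloisGroup (v.adicCompletion K), σ • v₀ = ρ σ • v₀ := fun σ => (hρ σ).1
  -- `hne` at the (N1′)-witness `τ₁ = c₁ • v₀`, after cancelling the unit `ι(p^c)`, then at `v₀` (§1)
  obtain ⟨τ₁, hτ₁⟩ := hN1'
  have hne₁ : BdRPlusTop.of (v.adicCompletion K) p (embBdRHom hpv (surjective_fontaineTheta_integerC hpv) A) * P₀ τ₁ +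
      BdRPlusTop.of (v.adicCompletion K) p (embBdRHom hpv (surjective_fontaineTheta_integerC hpv) B) * Q₀ τ₁ ≠ 0 := by
    have h := hneΩ τ₁ hτ₁
    rw [← hA', ← hB', map_mul, map_mul, map_mul, map_mul, mul_assoc, mul_assoc, ← mul_add] at h
    exact right_ne_zero_of_mul h
  obtain ⟨c₁, hc₁⟩ := hgen τ₁
  rw [hP₀, hQ₀, hc₁] at hne₁
  have hne := hodgeCombination_ne_zero_of_smul hpv (surjective_fontaineTheta_integerC hpv) LT hsmul A B c₁ v₀ hne₁
  -- the unit root `α` of `X² − a_pX + p` (`‖a_p‖ = 1`: ORDINARY)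
  obtain ⟨α, π, hα, hαroot, haπ, hαπ⟩ := exists_unitRoot_frobeniusPoly ((HasseManin.tr (E₀.map (Int.castRingHom (ZMod p))) : ℤ) : ℤ_[p]) hnorm
  -- the unit-root frame along `φ` (p797918), applied STEPWISE
  have hU1 := exists_const_tatePairingPoint_eq_neg_trace_unitRoot_formalPoint_transport v hpv Dv Wm ψm hψm hΔ W φ hφ Tφ hTφ
    e hμ hadd₁ hadd₂ hgal hcompat E₀ hWE (N := N) hN (LT := LT)
  have hU2 := hU1 hLT hsmul hgalLT hv₀ hgen ρ hρv A B dHL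
  have hU3 := hU2 hHL hα hαπ hαroot haπ hne ψ hψ hψlog
  have hU4 := hU3 heL healt henondeg
  exact hU4 hinj hde d

end Completion

end Summit.BirchSwinnertonDyer.BirchSwinnertonDyer.Theorems.UnitRootReciprocityTransport

end
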